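import Summits.Ventures.CertifiedArithmetic.LowPrec.SRPythagorasMeanMonotone
import HarnessLib

/-!
# Stochastic rounding in low-precision formats CXIV — the pair-deficit EXCHANGE LEMMA of
# limited-randomness SR (IEEE P3109 StochasticA, every number `N ≥ 1` of random bits)

HONEST FRAMING: certified error envelopes and provably optimal rounding/accumulation schemes for
low-precision formats under stated cost models; every table by two implementations; no hardware or
vendor claims.

On a one-signed nested window (`NestedWindow F lo hi g J`, `0 ≤ lo`; `G = 2^J·g`, `E = G/2^N`) let
`Def_n(t) = n·E + (E[ŝₙ | t] − (t + Σx)) ∈ [0, n·E]` be the bias DEFICIT of the `n`-step StochasticA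
tree from `t` (`deficit`, `deficit_nonneg_le`).  `NestedWindow.deficit_pair`: for window states
`t ≤ t'` fed the same summands, `Def_n(t') ≤ 3·Def_n(t) + E·[t' − t ∉ Eℤ]`; so in a TOP cell
`Def(up) ≤ 3·Def(dn)` (`deficit_up_le_three_dn`) — the exchange input that every local criterion of
CX/CXI lacks and that CXV (`SRPythagorasTwoBits`) turns into the Pythagorean law for two bits on
every tree.  Proof: induction over the PAIR of trees under a monotone three-outcome coupling
(`stepQ_couple3`, CXII), alignment of children on the grid (`aligned_child`,
`truncErr_eq_of_aligned_top`, CVI `coarse`) and the cell formula `|β(c)| = resid (c − ⌊c̄⌋) (w/2^N)`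
(`cellA`, XCIII).  Certificate `certs/sr/gen21/twobits` (two implementations, exact, byte-identical):
0 violations at the 23 781 663 ordered same-depth state pairs of 46 665 trees, `N ≤ 3` (largest
top-cell ratio `Def(up)/Def(dn)`: `23/15, 5/3, 8/5` at `N = 1, 2, 3`).  Prior art: [ElararEtAl2025,
Rem. 3] (bias of `SR_{p,r}` = truncation error); no coupling argument for `SR_{p,r}` was found
(cell file FRESHNESS-SR, question Y); no Mathlib precedent.
-/

namespace Summit.Ventures.CertifiedArithmetic.LowPrec.SR

open Literature.ComputerArithmetic.ConnollyHighamMary2021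
open Finset

variable {K : Type*} [Field K] [LinearOrder K] [IsStrictOrderedRing K] [FloorRing K]

namespace LimitedBits

/-! ### 1. Deficits of StochasticA trees -/

/-- Bias DEFICIT `n·E + (E[ŝₙ] − (t + Σ x))`, `E = G/2^N`, of the `n`-step StochasticA tree from `t`:
the amount by which the towards-zero bias falls short of its maximum `n·E`. -/
def deficit (F : Finset K) (N : ℕ) (G : K) (x : ℕ → K) (n : ℕ) (t : K) : K :=
  n * (G / 2 ^ N) + (accExpQ F (probAwayA N) x n (fun y => y) t - (t + ∑ i ∈ range n, x i))

omit [IsStrictOrderedRing K] in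
/-- No steps: no deficit. -/
theorem deficit_zero (F : Finset K) (N : ℕ) (G : K) (x : ℕ → K) (t : K) :
    deficit F N G x 0 t = 0 := by
  simp [deficit, accExpQ]

omit [IsStrictOrderedRing K] in
/-- One step: `Def_{n+1}(t) = E_c[Def_n(child)] + (E + (τ(c) − c))`, `c = t + x₀`, `τ` the step mean. -/
theorem deficit_succ (F : Finset K) (N : ℕ) (G : K) (x : ℕ → K) (n : ℕ) (t : K) :
    deficit F N G x (n + 1) t
      = stepQ F (probAwayA N) (t + x 0) (deficit F N G (fun i => x (i + 1)) n)
        + (G / 2 ^ N + (stepQ F (probAwayA N) (t + x 0) (fun y => y) - (t + x 0))) := by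
  simp only [deficit, accExpQ, stepQ]
  rw [Finset.sum_range_succ']
  push_cast
  ring

/-- The misalignment penalty: `0` if `t' − t ∈ ρℤ`, else `ρ`. -/
noncomputable def alignPen (ρ t t' : K) : K := by
  classical exact if ∃ k : ℤ, t' - t = k * ρ then 0 else ρ

omit [LinearOrder K] [IsStrictOrderedRing K] [FloorRing K] in
/-- Aligned pairs pay no penalty. -/
theorem alignPen_of_aligned {ρ t t' : K} (h : ∃ k : ℤ, t' - t = k * ρ) : alignPen ρ t t' = 0 := by
  classical
  unfold alignPen; simp [h]

omit [LinearOrder K] [IsStrictOrderedRing K] [FloorRing K] in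
/-- Misaligned pairs pay `ρ`. -/
theorem alignPen_of_not {ρ t t' : K} (h : ¬ ∃ k : ℤ, t' - t = k * ρ) : alignPen ρ t t' = ρ := by
  classical
  unfold alignPen; simp [h]

omit [IsStrictOrderedRing K] [FloorRing K] in
/-- `0 ≤ alignPen ≤ ρ`. -/
theorem alignPen_nonneg_le {ρ : K} (hρ : 0 ≤ ρ) (t t' : K) :
    0 ≤ alignPen ρ t t' ∧ alignPen ρ t t' ≤ ρ := by
  classical
  by_cases h : ∃ k : ℤ, t' - t = k * ρ
  · rw [alignPen_of_aligned h]; exact ⟨le_rfl, hρ⟩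
  · rw [alignPen_of_not h]; exact ⟨hρ, le_rfl⟩

namespace NestedWindow

variable {F : Finset K} {lo hi g : K} {J : ℕ}

/-- **StochasticA under-estimates in the mean on one-signed windows**: `E[ŝₙ] ≤ sₙ`. -/
theorem accExpQA_id_le (hW : NestedWindow F lo hi g J) (hlo : 0 ≤ lo) (N : ℕ) :
    ∀ (x : ℕ → K) (n : ℕ) (t : K), NoSat F x n t → InWindow F lo hi x n t →
      accExpQ F (probAwayA N) x n (fun y => y) t ≤ t + ∑ i ∈ range n, x i := by
  intro x n
  induction n generalizing x with
  | zero => intro t _ _; simp [accExpQ]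
  | succ n ih =>
    rintro t ⟨hin, hnu, hnd⟩ ⟨⟨h1, h2⟩, hwu, hwd⟩
    rw [clamp_eq_self hin] at h1 h2
    obtain ⟨-, -, hlod, -, -, -⟩ := hW.cand h1 h2
    have hτ := (dn_le_stepQA_le F N (hW.inHull h1 h2) (hlo.trans hlod)).2
    have IHu := ih (fun i => x (i + 1)) (up F (t + x 0)) hnu hwu
    have IHd := ih (fun i => x (i + 1)) (dn F (t + x 0)) hnd hwd
    obtain ⟨hp0, hp1⟩ := pUpQ_mem F (probAwayA_mem N) (t + x 0)
    simp only [accExpQ]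
    simp only [stepQ] at hτ ⊢
    rw [Finset.sum_range_succ']
    linarith [mul_le_mul_of_nonneg_left IHu hp0, mul_le_mul_of_nonneg_left IHd (sub_nonneg.mpr hp1)]

/-- `0 ≤ Def ≤ n·E` (`|bias| ≤ n·2^{-N}·G`, II `abs_accExpQ_id_sub_le`; bias `≤ 0`). -/
theorem deficit_nonneg_le (hW : NestedWindow F lo hi g J) (hlo : 0 ≤ lo) (N : ℕ) (x : ℕ → K) (n : ℕ)
    (t : K) (hns : NoSat F x n t) (hw : InWindow F lo hi x n t) :
    0 ≤ deficit F N (2 ^ J * g) x n t ∧ deficit F N (2 ^ J * g) x n t ≤ n * (2 ^ J * g / 2 ^ N) := by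
  have hb := abs_accExpQ_id_sub_le F (probAwayA_mem N) (fun η _ _ => abs_probAwayA_sub_le N η) x n t hns
    (hW.gapLE x n t hw)
  have hs := hW.accExpQA_id_le hlo N x n t hns hw
  have e : (n : K) * (1 / 2 ^ N * (2 ^ J * g)) = n * (2 ^ J * g / 2 ^ N) := by ring
  rw [e] at hb
  unfold deficit
  constructor <;> linarith [(abs_le.mp hb).1]

/-! ### 2. Alignment on the grid of a nested window -/

/-- **Children are aligned**: if the cell of the window point `c` is nondegenerate of width `2^i·ρ`,
each candidate of `c` and every point of `F` above it in the window differ by a multiple of `ρ`. -/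
theorem aligned_child (hW : NestedWindow F lo hi g J) {c : K} (h1 : lo ≤ c) (h2 : c ≤ hi)
    (hne : up F c ≠ dn F c) {ρ : K} {i : ℕ} (hwρ : up F c - dn F c = 2 ^ i * ρ) {a a' : K}
    (ha : a = dn F c ∨ a = up F c) (ha' : a' ∈ F) (haa : a ≤ a') (hah : a' ≤ hi) :
    ∃ k : ℤ, a' - a = k * ρ := by
  obtain ⟨hdF, huF, hlod, huhi, hdc, hcu⟩ := hW.cand h1 h2
  have hz : ∃ z : ℤ, a' - dn F c = z * (up F c - dn F c) := by
    rcases le_or_gt (up F c) a' with hua | hlt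
    · exact hW.coarse h1 h2 hne a' ha' hua hah
    · have h' : a' ≤ dn F c := le_dn_of_lt_up ha' hlt
      have hda : dn F c ≤ a' := by rcases ha with rfl | rfl; exact haa; exact (dn_le_up F c).trans haa
      exact ⟨0, by rw [le_antisymm h' hda]; ring⟩
  obtain ⟨z, hz⟩ := hz
  rcases ha with rfl | rfl
  · exact ⟨z * 2 ^ i, by push_cast; rw [hz, hwρ]; ring⟩
  · exact ⟨(z - 1) * 2 ^ i, by push_cast; linear_combination hz + (z - 1 : K) * hwρ⟩

/-- Cell data of a nondegenerate window point for StochasticA with `N` bits: width `2^j·g` (`j ≤ J`),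
step mean `τ(c) = c − resid (c − ⌊c̄⌋) (2^j g/2^N)` and `0 ≤ c − τ(c) < 2^j·g/2^N`. -/
theorem cellA (hW : NestedWindow F lo hi g J) (hlo : 0 ≤ lo) (N : ℕ) {c : K} (h1 : lo ≤ c) (h2 : c ≤ hi)
    (hne : up F c ≠ dn F c) :
    ∃ j : ℕ, j ≤ J ∧ up F c - dn F c = 2 ^ j * g ∧
      stepQ F (probAwayA N) c (fun y => y) = c - resid (c - dn F c) (2 ^ j * g / 2 ^ N) ∧
      0 ≤ c - stepQ F (probAwayA N) c (fun y => y) ∧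
      c - stepQ F (probAwayA N) c (fun y => y) < 2 ^ j * g / 2 ^ N := by
  obtain ⟨j, hj, hwj⟩ := hW.width c h1 h2 hne
  obtain ⟨-, -, hlod, -, -, -⟩ := hW.cand h1 h2
  have hg := hW.pos
  have hρ : (0 : K) < 2 ^ j * g / 2 ^ N := by positivity
  have hw : up F c = dn F c ∨ up F c = dn F c + 2 ^ N * (2 ^ j * g / 2 ^ N) :=
    Or.inr (by rw [mul_div_cancel₀ _ (by positivity : (2 : K) ^ N ≠ 0)]; linarith)
  have hτ := stepQA_cell F N (hW.inHull h1 h2) (hlo.trans hlod) hρ hw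
  have hr := resid_nonneg_lt (y := c - dn F c) hρ
  exact ⟨j, hj, hwj, hτ, by rw [hτ]; linarith [hr.1], by rw [hτ]; linarith [hr.2]⟩

/-- **Aligned partners in a top cell have the same truncation error**: if `c ≤ c'` are window
points, the cell of `c` has the top width and `c' − c ∈ (2^J g/2^N)ℤ`, then `c − τ(c) = c' − τ(c')`
(both offsets are read modulo the top sub-quantum from top-grid points). -/
theorem truncErr_eq_of_aligned_top (hW : NestedWindow F lo hi g J) (hlo : 0 ≤ lo) (N : ℕ) {c c' : K}
    (h1 : lo ≤ c) (hcc : c ≤ c') (h2 : c' ≤ hi) (htop : up F c - dn F c = 2 ^ J * g) {k : ℤ}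
    (hk : c' - c = k * (2 ^ J * g / 2 ^ N)) :
    c - stepQ F (probAwayA N) c (fun y => y) = c' - stepQ F (probAwayA N) c' (fun y => y) := by
  have hg := hW.pos
  have hF : F.Nonempty := ⟨lo, hW.lo_mem⟩
  set G : K := 2 ^ J * g with hG
  set ρ : K := G / 2 ^ N with hρ
  have hρp : 0 < ρ := by positivity
  have hGρ : G = 2 ^ N * ρ := by rw [hρ, mul_div_cancel₀ _ (by positivity : (2 : K) ^ N ≠ 0)]
  have hc := hW.inHull h1 (hcc.trans h2)
  have hc' := hW.inHull (h1.trans hcc) h2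
  obtain ⟨hdF, huF, hlod, huhi, hdc, hcu⟩ := hW.cand h1 (hcc.trans h2)
  obtain ⟨hdF', huF', hlod', huhi', hdc', hcu'⟩ := hW.cand (h1.trans hcc) h2
  have hGp : (0 : K) < 2 ^ J * g := by positivity
  have hne : up F c ≠ dn F c := by
    intro h
    rw [h, sub_self] at htop
    linarith
  have hw : up F c = dn F c ∨ up F c = dn F c + 2 ^ N * ρ := Or.inr (by rw [← hGρ]; linarith)
  have hτ := stepQA_cell F N hc (hlo.trans hlod) hρp hw
  have hz : ∃ z : ℤ, dn F c' - dn F c = z * G := by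
    rcases le_or_gt (up F c) (dn F c') with hsep | hlt
    · obtain ⟨z, hz⟩ := hW.coarse h1 (hcc.trans h2) hne (dn F c') hdF' hsep (hdc'.trans h2)
      exact ⟨z, by rw [hz, htop]⟩
    · exact ⟨0, by rw [(hW.cell_eq h1 hcc h2 hlt).1]; ring⟩
  obtain ⟨z, hz⟩ := hz
  by_cases hne' : up F c' = dn F c'
  · -- `c'` exact: both errors vanish
    have hc'd : c' = dn F c' := le_antisymm (hne' ▸ hcu') hdc'
    have hτ' : stepQ F (probAwayA N) c' (fun y => y) = c' := by
      have := dn_le_stepQA_le F N hc' (hlo.trans hlod')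
      rw [← hc'd] at this; exact le_antisymm this.2 this.1
    have e : c - dn F c = 0 + ((z * 2 ^ N - k : ℤ) : K) * ρ := by
      push_cast; linear_combination hz - hk + hc'd + (z : K) * hGρ
    have hr : resid (c - dn F c) ρ = 0 := by
      rw [e, resid_add_mul hρp]; simp [resid]
    rw [hτ, hτ', hr]; ring
  · -- `c'` in a top cell, left endpoints congruent mod `G`
    obtain ⟨j', hj', hwj'⟩ := hW.width c' (h1.trans hcc) h2 hne'
    have hmono := hW.mono c c' h1 hcc h2 hne'
    rw [htop, hwj'] at hmono
    have hle : (2 : K) ^ j' * g ≤ 2 ^ J * g :=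
      mul_le_mul_of_nonneg_right (pow_le_pow_right₀ (by norm_num) hj') hg.le
    have htop' : up F c' - dn F c' = G := by rw [hwj']; exact le_antisymm hle hmono
    have hw' : up F c' = dn F c' ∨ up F c' = dn F c' + 2 ^ N * ρ := Or.inr (by rw [← hGρ]; linarith)
    have hτ' := stepQA_cell F N hc' (hlo.trans hlod') hρp hw'
    have e : c' - dn F c' = (c - dn F c) + ((k - z * 2 ^ N : ℤ) : K) * ρ := by
      push_cast; linear_combination hk - hz - (z : K) * hGρ
    rw [hτ, hτ', e, resid_add_mul hρp]; ring

/-! ### 3. The monotone coupling with exchange constant `3` -/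

/-- **Coupling step.**  If `V a' ≤ 3·V a + e` for every ORDERED pair of candidates `a ≤ a'` of the
window points `c ≤ c'`, then `E_{c'}[V] ≤ 3·E_c[V] + e` (product coupling across cells; inside one
cell the monotone coupling `(up,up)` w.p. `π`, `(dn,dn)` w.p. `1−π'`, `(dn,up)` w.p. `π'−π`, CXII). -/
theorem stepQ_couple3 (hW : NestedWindow F lo hi g J) (N : ℕ) {c c' : K} (h1 : lo ≤ c) (hcc : c ≤ c')
    (h2 : c' ≤ hi) (V : K → K) (e : K)
    (h : ∀ a a', (a = dn F c ∨ a = up F c) → (a' = dn F c' ∨ a' = up F c') → a ≤ a' →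
      V a' ≤ 3 * V a + e) :
    stepQ F (probAwayA N) c' V ≤ 3 * stepQ F (probAwayA N) c V + e := by
  have hF : F.Nonempty := ⟨lo, hW.lo_mem⟩
  obtain ⟨hp0, hp1⟩ := pUpQ_mem F (probAwayA_mem N) c
  obtain ⟨hp0', hp1'⟩ := pUpQ_mem F (probAwayA_mem N) c'
  have hdu := dn_le_up F c
  have hdu' := dn_le_up F c'
  by_cases hsep : up F c ≤ dn F c'
  · -- distinct cells: product coupling
    have a1 := h _ _ (Or.inl rfl) (Or.inl rfl) (hdu.trans hsep)
    have a2 := h _ _ (Or.inl rfl) (Or.inr rfl) (hdu.trans (hsep.trans hdu'))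
    have a3 := h _ _ (Or.inr rfl) (Or.inl rfl) hsep
    have a4 := h _ _ (Or.inr rfl) (Or.inr rfl) (hsep.trans hdu')
    simp only [stepQ]
    linarith [mul_nonneg (sub_nonneg.mpr hp1') (mul_nonneg (sub_nonneg.mpr hp1) (sub_nonneg.mpr a1)),
      mul_nonneg hp0' (mul_nonneg (sub_nonneg.mpr hp1) (sub_nonneg.mpr a2)),
      mul_nonneg (sub_nonneg.mpr hp1') (mul_nonneg hp0 (sub_nonneg.mpr a3)),
      mul_nonneg hp0' (mul_nonneg hp0 (sub_nonneg.mpr a4))]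
  · -- same cell: monotone coupling
    obtain ⟨hdd, huu⟩ := hW.cell_eq h1 hcc h2 (not_le.mp hsep)
    have hlt : dn F c < up F c := by rw [← hdd]; exact not_le.mp hsep
    have hτ := stepQ_mono_arg hF (probAwayA_mem N) (probAwayA_monotoneOn N) (f := fun y : K => y)
      (fun _ _ hab => hab) hcc
    simp only [stepQ] at hτ
    rw [hdd, huu] at hτ
    have hππ : pUpQ F (probAwayA N) c ≤ pUpQ F (probAwayA N) c' := by
      have : pUpQ F (probAwayA N) c * (up F c - dn F c)
          ≤ pUpQ F (probAwayA N) c' * (up F c - dn F c) := by linarith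
      exact le_of_mul_le_mul_right this (sub_pos.mpr hlt)
    have a1 : V (dn F c) ≤ 3 * V (dn F c) + e := h _ _ (Or.inl rfl) (Or.inl hdd.symm) le_rfl
    have a2 : V (up F c) ≤ 3 * V (dn F c) + e := h _ _ (Or.inl rfl) (Or.inr huu.symm) hdu
    have a4 : V (up F c) ≤ 3 * V (up F c) + e := h _ _ (Or.inr rfl) (Or.inr huu.symm) le_rfl
    simp only [stepQ]
    rw [hdd, huu]
    linarith [mul_nonneg hp0 (sub_nonneg.mpr a4), mul_nonneg (sub_nonneg.mpr hp1') (sub_nonneg.mpr a1),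
      mul_nonneg (sub_nonneg.mpr hππ) (sub_nonneg.mpr a2)]

/-! ### 4. The pair-deficit exchange lemma -/

/-- **PAIR-DEFICIT EXCHANGE LEMMA** (every `N ≥ 1`, every `J`).  On a one-signed nested window, for
states `t ≤ t'` fed the same summands (both trees unsaturated, inside the window):
`Def_n(t') ≤ 3·Def_n(t) + E·[t' − t ∉ (G/2^N)ℤ]`, `G = 2^J·g`, `E = G/2^N`. -/
theorem deficit_pair (hW : NestedWindow F lo hi g J) (hlo : 0 ≤ lo) {N : ℕ} (hN : 1 ≤ N) :
    ∀ (x : ℕ → K) (n : ℕ) (t t' : K), t ≤ t' →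
      NoSat F x n t → InWindow F lo hi x n t → NoSat F x n t' → InWindow F lo hi x n t' →
      deficit F N (2 ^ J * g) x n t'
        ≤ 3 * deficit F N (2 ^ J * g) x n t + alignPen (2 ^ J * g / 2 ^ N) t t' := by
  have hg := hW.pos
  have hF : F.Nonempty := ⟨lo, hW.lo_mem⟩
  set G : K := 2 ^ J * g with hG
  set ρ : K := G / 2 ^ N with hρ
  have hρp : 0 < ρ := by positivity
  intro x n
  induction n generalizing x with
  | zero =>
    intro t t' _ _ _ _ _
    rw [deficit_zero, deficit_zero]
    linarith [(alignPen_nonneg_le hρp.le t t').1]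
  | succ n ih =>
    rintro t t' htt ⟨hin, hnu, hnd⟩ ⟨⟨h1, h2⟩, hwu, hwd⟩ ⟨hin', hnu', hnd'⟩ ⟨⟨h1', h2'⟩, hwu', hwd'⟩
    rw [clamp_eq_self hin] at h1 h2
    rw [clamp_eq_self hin'] at h1' h2'
    set x' : ℕ → K := fun i => x (i + 1) with hx'
    set c := t + x 0 with hc
    set c' := t' + x 0 with hc'
    have hcc : c ≤ c' := by rw [hc, hc']; linarith
    obtain ⟨hdF, huF, hlod, huhi, hdc, hcu⟩ := hW.cand h1 h2
    obtain ⟨hdF', huF', hlod', huhi', hdc', hcu'⟩ := hW.cand h1' h2'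
    have hpen := alignPen_nonneg_le hρp.le t t'
    have hτc := (dn_le_stepQA_le F N (hW.inHull h1 h2) (hlo.trans hlod)).2
    have hτc' := (dn_le_stepQA_le F N (hW.inHull h1' h2') (hlo.trans hlod')).2
    set V : K → K := deficit F N G x' n with hV
    have IH0 : ∀ a a', (a = dn F c ∨ a = up F c) → (a' = dn F c' ∨ a' = up F c') → a ≤ a' →
        V a' ≤ 3 * V a + alignPen ρ a a' := by
      intro a a' ha ha' hle
      rcases ha with rfl | rfl <;> rcases ha' with rfl | rfl
      · exact ih x' _ _ hle hnd hwd hnd' hwd'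
      · exact ih x' _ _ hle hnd hwd hnu' hwu'
      · exact ih x' _ _ hle hnu hwu hnd' hwd'
      · exact ih x' _ _ hle hnu hwu hnu' hwu'
    have IHE : ∀ a a', (a = dn F c ∨ a = up F c) → (a' = dn F c' ∨ a' = up F c') → a ≤ a' →
        V a' ≤ 3 * V a + ρ := fun a a' ha ha' hle =>
      (IH0 a a' ha ha' hle).trans (by linarith [(alignPen_nonneg_le hρp.le a a').2])
    have hcoupE : stepQ F (probAwayA N) c' V ≤ 3 * stepQ F (probAwayA N) c V + ρ :=
      hW.stepQ_couple3 N h1 hcc h2' V ρ IHE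
    have ha'F : ∀ a', (a' = dn F c' ∨ a' = up F c') → a' ∈ F ∧ a' ≤ hi := by
      rintro a' (rfl | rfl); exact ⟨hdF', hdc'.trans h2'⟩; exact ⟨huF', huhi'⟩
    rw [deficit_succ, deficit_succ]
    show stepQ F (probAwayA N) c' V + (G / 2 ^ N + (stepQ F (probAwayA N) c' (fun y => y) - c'))
      ≤ 3 * (stepQ F (probAwayA N) c V + (G / 2 ^ N + (stepQ F (probAwayA N) c (fun y => y) - c)))
        + alignPen ρ t t'
    rw [← hρ]
    by_cases hne : up F c = dn F c
    · -- `c` exact: `τ(c) = c`, the penalty `ρ` of the coupling is affordable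
      have hcd : c = dn F c := le_antisymm (hne ▸ hcu) hdc
      have hτ : stepQ F (probAwayA N) c (fun y => y) = c := by
        have := dn_le_stepQA_le F N (hW.inHull h1 h2) (hlo.trans hlod)
        rw [← hcd] at this; exact le_antisymm this.2 this.1
      rw [hτ]; linarith [hpen.1]
    · obtain ⟨j, hj, hwj, -, hβ0, hβlt⟩ := hW.cellA hlo N h1 h2 hne
      by_cases hjN : J ≤ j + N
      · -- the width is a multiple of `ρ`: children stay aligned, coupling without penalty
        have hwρ : up F c - dn F c = 2 ^ (j + N - J) * ρ := by
          have h2N : (2 : K) ^ N ≠ 0 := by positivity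
          have e : (2 : K) ^ (j + N - J) * 2 ^ J = 2 ^ j * 2 ^ N := by
            rw [← pow_add, ← pow_add]; congr 1; omega
          rw [hwj, hρ, hG, ← mul_div_assoc, eq_div_iff h2N]
          linear_combination (-g) * e
        have IHA : ∀ a a', (a = dn F c ∨ a = up F c) → (a' = dn F c' ∨ a' = up F c') → a ≤ a' →
            V a' ≤ 3 * V a + 0 := by
          intro a a' ha ha' hle
          have h0 := IH0 a a' ha ha' hle
          rwa [alignPen_of_aligned (hW.aligned_child h1 h2 hne hwρ ha (ha'F a' ha').1 hle (ha'F a' ha').2)]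
            at h0
        have hcoup0 : stepQ F (probAwayA N) c' V ≤ 3 * stepQ F (probAwayA N) c V + 0 :=
          hW.stepQ_couple3 N h1 hcc h2' V 0 IHA
        rcases Nat.lt_or_ge j J with hjlt | hjge
        · -- finer than the top cell: `c − τ(c) < ρ/2`
          have hhalf : (2 : K) ^ j * g / 2 ^ N ≤ ρ / 2 := by
            have h2j : (2 : K) ^ j * 2 ≤ 2 ^ J := by
              rw [← pow_succ]; exact pow_le_pow_right₀ (by norm_num) (by omega)
            have h1 : (2 : K) ^ j * g ≤ 2 ^ J * g / 2 := by
              rw [le_div_iff₀ (by norm_num : (0 : K) < 2)]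
              calc (2 : K) ^ j * g * 2 = 2 ^ j * 2 * g := by ring
                _ ≤ 2 ^ J * g := mul_le_mul_of_nonneg_right h2j hg.le
            calc (2 : K) ^ j * g / 2 ^ N ≤ (2 ^ J * g / 2) / 2 ^ N :=
                  div_le_div_of_nonneg_right h1 (by positivity)
              _ = ρ / 2 := by rw [hρ, hG]; ring
          linarith [hpen.1]
        · -- top cell
          have hjJ : j = J := le_antisymm hj hjge
          rw [hjJ] at hwj hβlt
          by_cases hal : ∃ k : ℤ, t' - t = k * ρ
          · obtain ⟨k, hk⟩ := hal
            rw [alignPen_of_aligned ⟨k, hk⟩]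
            have hk' : c' - c = k * (2 ^ J * g / 2 ^ N) := by rw [hc, hc', ← hG, ← hρ, ← hk]; ring
            have heq := hW.truncErr_eq_of_aligned_top hlo N h1 hcc h2' hwj hk'
            have : (2 : K) ^ J * g / 2 ^ N = ρ := by rw [hρ, hG]
            rw [this] at hβlt
            linarith
          · rw [alignPen_of_not hal]
            have : (2 : K) ^ J * g / 2 ^ N = ρ := by rw [hρ, hG]
            rw [this] at hβlt
            linarith
      · -- finer than `ρ`: `c − τ(c) < ρ/4` (`N ≥ 1`), the penalty of the coupling is affordable
        have hquart : (2 : K) ^ j * g / 2 ^ N ≤ ρ / 4 := by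
          have h4j : (2 : K) ^ j * 4 ≤ 2 ^ J := by
            rw [show (4 : K) = 2 ^ 2 by norm_num, ← pow_add]
            exact pow_le_pow_right₀ (by norm_num) (by omega)
          have h1 : (2 : K) ^ j * g ≤ 2 ^ J * g / 4 := by
            rw [le_div_iff₀ (by norm_num : (0 : K) < 4)]
            calc (2 : K) ^ j * g * 4 = 2 ^ j * 4 * g := by ring
              _ ≤ 2 ^ J * g := mul_le_mul_of_nonneg_right h4j hg.le
          calc (2 : K) ^ j * g / 2 ^ N ≤ (2 ^ J * g / 4) / 2 ^ N :=
                div_le_div_of_nonneg_right h1 (by positivity)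
            _ = ρ / 4 := by rw [hρ, hG]; ring
        linarith [hpen.1]

/-- **Top-cell corollary** (the input of the two-bit budget): at a branch point whose cell has the top
width `G = 2^J·g`, `Def(up) ≤ 3·Def(dn)`, i.e. CX's drift gap obeys `Δ ≤ 2·Def(dn)`. -/
theorem deficit_up_le_three_dn (hW : NestedWindow F lo hi g J) (hlo : 0 ≤ lo) {N : ℕ} (hN : 1 ≤ N)
    (x : ℕ → K) (n : ℕ) {c : K} (htop : up F c - dn F c = 2 ^ J * g)
    (hnu : NoSat F x n (up F c)) (hwu : InWindow F lo hi x n (up F c))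
    (hnd : NoSat F x n (dn F c)) (hwd : InWindow F lo hi x n (dn F c)) :
    deficit F N (2 ^ J * g) x n (up F c) ≤ 3 * deficit F N (2 ^ J * g) x n (dn F c) := by
  have h := hW.deficit_pair hlo hN x n (dn F c) (up F c) (dn_le_up F c) hnd hwd hnu hwu
  have hal : ∃ k : ℤ, up F c - dn F c = k * (2 ^ J * g / 2 ^ N) :=
    ⟨2 ^ N, by push_cast; rw [htop, mul_div_cancel₀ _ (by positivity : (2 : K) ^ N ≠ 0)]⟩
  rwa [alignPen_of_aligned hal, add_zero] at h

end NestedWindow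

end LimitedBits

end Summit.Ventures.CertifiedArithmetic.LowPrec.SR
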